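import Summits.AnomalousDissipation.AnomalousDissipation.Theorems.GalerkinSteadyZerothLaw.Negative.StokesStates
import Literature.Analysis.FluidPDE.NSGalerkinStationary

/-!
# Stub `stub_decadeIVT` of the line `idea-sketch-ideator2` (card `euler-core-coat-readout`),
# crux stmt-AnomalousDissipation-2986 (`MirrorVariety.GalerkinSteadyZerothLaw`)

Pure topology: the decade sweep of the composition `GalerkinSteadyZerothLaw_of`. Let `K` be a connected set of
(clamp viscosity `ν`, coat `h`) pairs, `D` a real observable continuous on `K` with values in `[ε₁, M]` on `K`,
`0 < ε₁`, `0 < ρ`, `M < ρ² ε₁`, `0 < ν₀`, and suppose the first coordinates of `K` cover the decade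
`[ν₀, ρ ν₀]`. Then some `p ∈ K` satisfies `p.1² ε₁ = ν₀² D p` exactly.

Proof. `K` is non-empty (`IsConnected.nonempty`), so `ε₁ ≤ D q ≤ M < ρ² ε₁` at some `q ∈ K`; with `0 < ε₁`,
`0 < ρ` this forces `1 < ρ`, hence both endpoints `ν₀`, `ρ ν₀` lie in `[ν₀, ρ ν₀] ⊆ Prod.fst '' K`, giving
`p_lo, p_hi ∈ K` with first coordinates `ν₀` and `ρ ν₀`. For `f p := p.1² ε₁` (continuous) and
`g p := ν₀² D p` (continuous on `K`) we have `f p_lo = ν₀² ε₁ ≤ ν₀² D p_lo = g p_lo` and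
`g p_hi = ν₀² D p_hi ≤ ν₀² M ≤ ν₀² ρ² ε₁ = f p_hi`, so Mathlib's two-function intermediate value theorem on a
preconnected set, `IsPreconnected.intermediate_value₂`, yields `p ∈ K` with `f p = g p`.
-/

noncomputable section

-- `Summit.<Summit>.<Problem>` is the tree's mandated summit-side namespace (CONVENTIONS §2); deliberate duplicate.
set_option linter.dupNamespace false

open scoped InnerProductSpace Topology
open MeasureTheory Filter Set UnitAddTorus
open Literature.Analysis.FunctionSpaces Literature.Analysis.FunctionSpaces.Torus
open Literature.Analysis.FluidPDE Literature.Analysis.FluidPDE.Torus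

namespace Summit.AnomalousDissipation.AnomalousDissipation.Theorems.GalerkinSteadyZerothLaw

open Summit.AnomalousDissipation.AnomalousDissipation.Theorems.GalerkinSteadyZerothLaw.Negative
  (SteadyState BandLimited fieldOf steadyState_fieldOf integral_norm_sq_fieldOf loudness_fieldOf)
open Summit.AnomalousDissipation.AnomalousDissipation.Theorems.LaminarNeverLoud.Negative
  (modes forceCoeff energy dissipation modes_symm zero_not_mem_modes energy_nonneg dissipation_nonpos_of_nonpos
    isRealCoeff_forceCoeff)

/-- **stub_decadeIVT** (S).  Decade sweep / intermediate value step of the line: on a connected family `K` of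
(viscosity, coat) pairs whose first coordinates cover the decade `[ν₀, ρ ν₀]`, a continuous observable `D` with
values in `[ε₁, M]`, `M < ρ² ε₁`, is met EXACTLY by the parabola `ν ↦ ν² ε₁ / ν₀²` at some point of `K`:
`p.1 ^ 2 * ε₁ = ν₀ ^ 2 * D p`.  Two-function IVT on a preconnected set
(`IsPreconnected.intermediate_value₂`) between the endpoints `ν₀` and `ρ ν₀` of the decade. [folklore] -/
theorem stub_decadeIVT : ∀ (N : ℕ) (K : Set (ℝ × (↥(modes (Fin 3) N) → EuclideanSpace ℂ (Fin 3))))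
    (D : ℝ × (↥(modes (Fin 3) N) → EuclideanSpace ℂ (Fin 3)) → ℝ) (ε₁ M ρ ν₀ : ℝ),
    IsConnected K → ContinuousOn D K → 0 < ε₁ → 0 < ρ → M < ρ ^ 2 * ε₁ → 0 < ν₀ →
    (∀ p ∈ K, ε₁ ≤ D p ∧ D p ≤ M) → Set.Icc ν₀ (ρ * ν₀) ⊆ Prod.fst '' K →
    ∃ p ∈ K, p.1 ^ 2 * ε₁ = ν₀ ^ 2 * D p := by
  intro N K D ε₁ M ρ ν₀ hK hD hε₁ hρ hM hν₀ hbounds hcov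
  -- `K` is non-empty, so `ε₁ ≤ M < ρ² ε₁`, whence `1 < ρ`
  obtain ⟨q, hq⟩ := hK.nonempty
  have hε₁M : ε₁ ≤ M := (hbounds q hq).1.trans (hbounds q hq).2
  have hρ1 : 1 ≤ ρ := by
    by_contra h
    have hρlt : ρ < 1 := not_le.1 h
    have hρ2 : ρ ^ 2 ≤ 1 := by nlinarith
    have : ρ ^ 2 * ε₁ ≤ ε₁ := by nlinarith
    linarith
  -- both endpoints of the decade are first coordinates of points of `K`
  have hlo_mem : ν₀ ∈ Set.Icc ν₀ (ρ * ν₀) := ⟨le_rfl, by nlinarith⟩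
  have hhi_mem : ρ * ν₀ ∈ Set.Icc ν₀ (ρ * ν₀) := ⟨by nlinarith, le_rfl⟩
  obtain ⟨plo, hploK, hplo1⟩ := hcov hlo_mem
  obtain ⟨phi, hphiK, hphi1⟩ := hcov hhi_mem
  -- the two functions of the IVT
  have hf : ContinuousOn (fun p : ℝ × (↥(modes (Fin 3) N) → EuclideanSpace ℂ (Fin 3)) => p.1 ^ 2 * ε₁) K :=
    ((continuous_fst.pow 2).mul continuous_const).continuousOn
  have hg : ContinuousOn (fun p : ℝ × (↥(modes (Fin 3) N) → EuclideanSpace ℂ (Fin 3)) => ν₀ ^ 2 * D p) K :=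
    continuousOn_const.mul hD
  have hν₀sq : 0 ≤ ν₀ ^ 2 := sq_nonneg ν₀
  have hlo : (fun p : ℝ × (↥(modes (Fin 3) N) → EuclideanSpace ℂ (Fin 3)) => p.1 ^ 2 * ε₁) plo ≤
      (fun p : ℝ × (↥(modes (Fin 3) N) → EuclideanSpace ℂ (Fin 3)) => ν₀ ^ 2 * D p) plo := by
    show plo.1 ^ 2 * ε₁ ≤ ν₀ ^ 2 * D plo
    rw [hplo1]
    exact mul_le_mul_of_nonneg_left (hbounds plo hploK).1 hν₀sq
  have hhi : (fun p : ℝ × (↥(modes (Fin 3) N) → EuclideanSpace ℂ (Fin 3)) => ν₀ ^ 2 * D p) phi ≤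
      (fun p : ℝ × (↥(modes (Fin 3) N) → EuclideanSpace ℂ (Fin 3)) => p.1 ^ 2 * ε₁) phi := by
    show ν₀ ^ 2 * D phi ≤ phi.1 ^ 2 * ε₁
    rw [hphi1]
    have h1 : ν₀ ^ 2 * D phi ≤ ν₀ ^ 2 * M := mul_le_mul_of_nonneg_left (hbounds phi hphiK).2 hν₀sq
    have h2 : ν₀ ^ 2 * M ≤ ν₀ ^ 2 * (ρ ^ 2 * ε₁) := mul_le_mul_of_nonneg_left hM.le hν₀sq
    calc ν₀ ^ 2 * D phi ≤ ν₀ ^ 2 * (ρ ^ 2 * ε₁) := h1.trans h2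
      _ = (ρ * ν₀) ^ 2 * ε₁ := by ring
  obtain ⟨p, hpK, hpeq⟩ := hK.isPreconnected.intermediate_value₂ hploK hphiK hf hg hlo hhi
  exact ⟨p, hpK, hpeq⟩

end Summit.AnomalousDissipation.AnomalousDissipation.Theorems.GalerkinSteadyZerothLaw

end

-- buildfix 2026-08-20 (ops-buildfix-1 gen 7): enqueue-only re-land — rebuild after B-35 (StokesArc, p233893) healed this module's import closure; no declaration changed.
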